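import Literature.NumberTheory.Automorphic.ArchKirillovWeightOneGL2Real
import Literature.NumberTheory.Automorphic.ArchKirillovSignsGL2Real
import Literature.NumberTheory.Automorphic.ArchKirillovBesselGL2Real
import Literature.NumberTheory.Automorphic.ArchKirillovLowestWeightGL2Real
import Literature.NumberTheory.Automorphic.ArchKirillovFunctionGL2
import HarnessLib

/-!
# Shapes of the Kirillov functions at a real place, modulo the null space, with the sign `δ_w`
# (Jacquet–Langlands (1970), §5, Thm. 5.13, 5.15)

Topic `NumberTheory/Automorphic`; namespace `Literature.NumberTheory.Automorphic`. Theorems only (no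
definition, no named fact, no instance). The per-place input of the archimedean Hecke test vector of
`GL₂(K_∞)` at a REAL place `w`, in the form needed for the global assembly: for a functional `ℓ` on the
Gårding space continuous for the `U(𝔤)`-seminorms with `ℓ ∘ τ(X⁺_w) = θ ℓ`, and the sign
`δ_w = diag(-1_w, 1)`:

* `exists_seminormBound_comp_gardingAct` — `ℓ ∘ τ(g)` is again continuous for the `U(𝔤)`-seminorms when
  `‖τ(g)‖ ≤ 1` (`Ad(g)` on the words);
* **discrete-series type, modulo the null space** (`apply_gardingAct_expGL_eq_zero_of_lowering_mod`,
  `exists_apply_gardingAct_expGL_eq_of_raising_mod`, `realShape_discrete`): for a vector `v` of weight `k`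
  with `ℓ(τ(exp yH₀) L_w v) = 0` and `ℓ(τ(exp yH₀) τ(δ_w) L_w v) = 0` for all `y` (e.g. `L_w v` in the null
  space of the Kirillov map) and `iθ = a > 0`: `ℓ(τ(exp yH₀) v) = 0` for all `y` (moderate growth against
  `e^{a e^y}`) and `ℓ(τ(exp yH₀) τ(δ_w) v) = C e^{(μ+k)y/2} e^{-a e^y}`;
* **weight-one type, symmetrised** (`realShape_weightOne_symm`): for `v` of weight `1` with
  `(2κ)² = 2λ - μ² + 1`, `κ ≠ 0`, the `τ(δ_w)`-fixed vector `e = (1 + τ(δ_w))(v + (2κ)⁻¹ L_w v)` has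
  `ℓ(τ(exp yH₀) e) = c (e^y)^{(μ+1)/2} besselMode a (i(κ - ½)) (e^y)`;
* **weight-zero type** (`realShape_weightZero`, `realShape_weightZero_xSum`): for `v` of weight `0`,
  `ℓ(τ(exp yH₀) v) = c (e^y)^{μ/2} besselMode a ν (e^y)` (`λ = μ²/2 - 2ν² - ½`), and if `τ(δ_w) v = -v` the
  `τ(δ_w)`-fixed vector `τ(X⁺_w + X⁻_w) v = 2 τ(X⁺_w) v` has `ℓ(τ(exp yH₀) ·) = 2θ e^y · (the same)`.

## References

* H. Jacquet, R. P. Langlands, *Automorphic Forms on GL(2)*, LNM 114 (1970), §5 (Lemma 5.13.1, Thm. 5.13,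
  5.15). [JacquetLanglands1970]
* D. Bump, *Automorphic Forms and Representations* (1997), §2.8. [Bump1997]
-/

noncomputable section

open MeasureTheory Measure NumberField NumberField.InfinitePlace NumberField.mixedEmbedding IsDedekindDomain Set Filter
open scoped MatrixGroups Topology Classical

namespace Literature.NumberTheory.Automorphic

variable {K : Type} [Field K] [NumberField K]

-- as in `ArchGardingWhittaker`
set_option backward.isDefEq.respectTransparency false

/-! ### 1. `ℓ ∘ τ(g)` is continuous for the `U(𝔤)`-seminorms -/

section Transfer

variable {n : ℕ} {hcpt : isCompact_glFiniteIntegralLevel n K}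
  {E : Type*} [NormedAddCommGroup E] [NormedSpace ℂ E] [CompleteSpace E]
  {τ : ContRepresentation ℂ (AutomorphyDatum.gl n K hcpt).arch.carrier E}
  (hτ : τ.IsStronglyContinuous)

/-- **`ℓ ∘ τ(g)` is continuous for the `U(𝔤)`-seminorms** when `ℓ` is and `‖τ(g)‖ ≤ 1`:
`‖ℓ(τ(g)v)‖ ≤ C Σ_w ‖τ(w) τ(g) v‖ = C Σ_w ‖τ(g) τ(Ad(g⁻¹)w) v‖ ≤ C |𝒮| Σ_{w'} ‖τ(w') v‖` over the `Ad(g⁻¹)`-images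
`w'` of the words. [cite: JacquetLanglands1970, §5 (proof of Lemma 5.13.1)] -/
theorem exists_seminormBound_comp_gardingAct (hτb : ∀ g, ‖(τ g : E →L[ℂ] E)‖ ≤ 1)
    {ℓ : archGardingSpace hcpt τ →ₗ[ℂ] ℂ}
    (hℓ : ∃ (C : ℝ) (𝒮 : Finset (List (Matrix (Fin n) (Fin n) (mixedSpace K)))), 0 ≤ C ∧
      ∀ v : archGardingSpace hcpt τ, ‖ℓ v‖ ≤ C * ∑ w ∈ 𝒮, ‖archWordDerivE hcpt τ w v‖)
    (g : GL (Fin n) (mixedSpace K)) :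
    ∃ (C : ℝ) (𝒮 : Finset (List (Matrix (Fin n) (Fin n) (mixedSpace K)))), 0 ≤ C ∧
      ∀ v : archGardingSpace hcpt τ, ‖ℓ (gardingAct hτ g v)‖ ≤ C * ∑ w ∈ 𝒮, ‖archWordDerivE hcpt τ w v‖ := by
  obtain ⟨C, 𝒮, hC, h⟩ := hℓ
  set φ : List (Matrix (Fin n) (Fin n) (mixedSpace K)) → List (Matrix (Fin n) (Fin n) (mixedSpace K)) :=
    fun w => w.map fun X => ((g⁻¹ : GL (Fin n) (mixedSpace K)) : Matrix (Fin n) (Fin n) (mixedSpace K)) * X *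
      (g : Matrix (Fin n) (Fin n) (mixedSpace K)) with hφ
  refine ⟨C * 𝒮.card, 𝒮.image φ, by positivity, fun v => ?_⟩
  have h2 : ∀ w ∈ 𝒮, ‖archWordDerivE hcpt τ w ((gardingAct hτ g v : archGardingSpace hcpt τ) : E)‖ ≤
      ∑ w' ∈ 𝒮.image φ, ‖archWordDerivE hcpt τ w' v‖ := by
    intro w hw
    have e : archWordDerivE hcpt τ w ((gardingAct hτ g v : archGardingSpace hcpt τ) : E) =
        τ (toArch hcpt g) (archWordDerivE hcpt τ (φ w) v) := by
      rw [coe_gardingAct_apply, archWordDerivE_apply_toArch hτ g v.2 w]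
    calc ‖archWordDerivE hcpt τ w ((gardingAct hτ g v : archGardingSpace hcpt τ) : E)‖
        = ‖τ (toArch hcpt g) (archWordDerivE hcpt τ (φ w) v)‖ := by rw [e]
      _ ≤ ‖archWordDerivE hcpt τ (φ w) v‖ := by
          have h1 := (τ (toArch hcpt g) : E →L[ℂ] E).le_of_opNorm_le (hτb _) (archWordDerivE hcpt τ (φ w) v)
          rwa [one_mul] at h1
      _ ≤ ∑ w' ∈ 𝒮.image φ, ‖archWordDerivE hcpt τ w' v‖ :=
          Finset.single_le_sum (f := fun w' => ‖archWordDerivE hcpt τ w' v‖) (fun _ _ => norm_nonneg _)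
            (Finset.mem_image_of_mem φ hw)
  calc ‖ℓ (gardingAct hτ g v)‖ ≤ C * ∑ w ∈ 𝒮, ‖archWordDerivE hcpt τ w ((gardingAct hτ g v : archGardingSpace hcpt τ) : E)‖ := h _
    _ ≤ C * ∑ w ∈ 𝒮, ∑ w' ∈ 𝒮.image φ, ‖archWordDerivE hcpt τ w' v‖ := mul_le_mul_of_nonneg_left (Finset.sum_le_sum h2) hC
    _ = C * 𝒮.card * ∑ w' ∈ 𝒮.image φ, ‖archWordDerivE hcpt τ w' v‖ := by
        rw [Finset.sum_const, nsmul_eq_mul, mul_assoc]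

end Transfer

/-! ### 2. The real place: shapes modulo the null space -/

section RealPlace

variable {hcpt : isCompact_glFiniteIntegralLevel 2 K}
  {E : Type*} [NormedAddCommGroup E] [NormedSpace ℂ E] [CompleteSpace E]
  {τ : ContRepresentation ℂ (AutomorphyDatum.gl 2 K hcpt).arch.carrier E}
  (hτ : τ.IsStronglyContinuous) (w : {w : InfinitePlace K // IsReal w})

local notation "H₀" => Matrix.single (0 : Fin 2) (0 : Fin 2) ((Pi.single w 1, 0) : mixedSpace K)
local notation "H₁" => Matrix.single (1 : Fin 2) (1 : Fin 2) ((Pi.single w 1, 0) : mixedSpace K)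
local notation "X⁺" => Matrix.single (0 : Fin 2) (1 : Fin 2) ((Pi.single w 1, 0) : mixedSpace K)
local notation "X⁻" => Matrix.single (1 : Fin 2) (0 : Fin 2) ((Pi.single w 1, 0) : mixedSpace K)
local notation "D" => gardingEnd (hcpt := hcpt) (τ := τ) hτ
local notation "A[" y "]" => gardingAct (hcpt := hcpt) (τ := τ) hτ (expGL ((y : ℝ) • H₀))
local notation "Lo" => (gardingEnd (hcpt := hcpt) (τ := τ) hτ (H₀ - H₁) - Complex.I • gardingEnd (hcpt := hcpt) (τ := τ) hτ (X⁺ + X⁻))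
local notation "Ra" => (gardingEnd (hcpt := hcpt) (τ := τ) hτ (H₀ - H₁) + Complex.I • gardingEnd (hcpt := hcpt) (τ := τ) hτ (X⁺ + X⁻))

/-- **Growing direction vanishes, modulo the null space.** If `v` has weight `k`, `ℓ(τ(exp yH₀) L_w v) = 0` for
all `y` and `re(iθ) > 0`, then `ℓ(τ(exp yH₀) v) = 0` for all `y`: the ODE `g' = ((μ+k)/2 + iθe^y) g` forces
`g = C e^{(μ+k)y/2} e^{iθ e^y}`, incompatible with the moderate growth of matrix coefficients unless `C = 0`.
[cite: JacquetLanglands1970, §5 (Lemma 5.13.1, Thm. 5.13)] -/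
theorem apply_gardingAct_expGL_eq_zero_of_lowering_mod (hτb : ∀ g, ‖(τ g : E →L[ℂ] E)‖ ≤ 1)
    {ℓ : archGardingSpace hcpt τ →ₗ[ℂ] ℂ}
    (hℓ : ∃ (C : ℝ) (𝒮 : Finset (List (Matrix (Fin 2) (Fin 2) (mixedSpace K)))), 0 ≤ C ∧
      ∀ v : archGardingSpace hcpt τ, ‖ℓ v‖ ≤ C * ∑ w ∈ 𝒮, ‖archWordDerivE hcpt τ w v‖)
    {θ : ℂ} (hθ : ∀ u : archGardingSpace hcpt τ, ℓ (D X⁺ u) = θ * ℓ u) (hθi : 0 < (Complex.I * θ).re)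
    (k μ : ℂ) (v : archGardingSpace hcpt τ)
    (hW : D (X⁺ - X⁻) v = (Complex.I * k) • v) (hZ : D H₀ v + D H₁ v = μ • v)
    (hL : ∀ y : ℝ, ℓ (A[y] (Lo v)) = 0) (y : ℝ) :
    ℓ (A[y] v) = 0 := by
  have hder : ∀ y : ℝ, HasDerivAt (fun x : ℝ => ℓ (A[x] v))
      (((μ + k) / 2 + Complex.I * θ * (Real.exp y : ℂ)) * ℓ (A[y] v)) y := fun y => by
    have h := hasDerivAt_apply_gardingAct_expGL_lowering hτ w hℓ hθ k μ v hW hZ y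
    rw [hL y, mul_zero, add_zero] at h
    exact h
  obtain ⟨C, hC⟩ := exists_eq_const_mul_exp_of_hasDerivAt
    (g := fun y : ℝ => (μ + k) / 2 + Complex.I * θ * (Real.exp y : ℂ))
    (G := fun y : ℝ => (μ + k) / 2 * y + Complex.I * θ * (Real.exp y : ℂ)) hder fun y => by
      have h := ((hasDerivAt_id y).ofReal_comp.const_mul ((μ + k) / 2)).add
        ((hasDerivAt_ofReal_exp y).const_mul (Complex.I * θ))
      exact h.congr_deriv (by push_cast; ring)
  obtain ⟨M, N, -, hgrow⟩ := exists_norm_apply_gardingAct_expGL_le hτ w hτb hℓ v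
  have hC0 : C = 0 := by
    refine eq_zero_of_norm_mul_exp_exp_le (β := ((μ + k) / 2).re) (M := M) (N := N) hθi fun x hx => ?_
    have h := hgrow x
    rw [abs_of_nonneg hx, hC x, norm_mul, Complex.norm_exp, Complex.add_re, Complex.re_mul_ofReal,
      Complex.re_mul_ofReal, Real.exp_add, ← mul_assoc] at h
    exact h
  rw [hC y, hC0, zero_mul]

/-- **Decaying direction, modulo the null space.** If `v` has weight `k` and `ℓ(τ(exp yH₀) R_w v) = 0` for all
`y`, then `ℓ(τ(exp yH₀) v) = C e^{(μ-k)y/2} e^{-iθ e^y}`. [cite: JacquetLanglands1970, §5 and Thm. 5.15] -/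
theorem exists_apply_gardingAct_expGL_eq_of_raising_mod {ℓ : archGardingSpace hcpt τ →ₗ[ℂ] ℂ}
    (hℓ : ∃ (C : ℝ) (𝒮 : Finset (List (Matrix (Fin 2) (Fin 2) (mixedSpace K)))), 0 ≤ C ∧
      ∀ v : archGardingSpace hcpt τ, ‖ℓ v‖ ≤ C * ∑ w ∈ 𝒮, ‖archWordDerivE hcpt τ w v‖)
    {θ : ℂ} (hθ : ∀ u : archGardingSpace hcpt τ, ℓ (D X⁺ u) = θ * ℓ u)
    (k μ : ℂ) (v : archGardingSpace hcpt τ)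
    (hW : D (X⁺ - X⁻) v = (Complex.I * k) • v) (hZ : D H₀ v + D H₁ v = μ • v)
    (hR : ∀ y : ℝ, ℓ (A[y] (Ra v)) = 0) :
    ∃ C : ℂ, ∀ y : ℝ, ℓ (A[y] v) = C * Complex.exp ((μ - k) / 2 * y - Complex.I * θ * (Real.exp y : ℂ)) := by
  have hder : ∀ y : ℝ, HasDerivAt (fun x : ℝ => ℓ (A[x] v))
      (((μ - k) / 2 - Complex.I * θ * (Real.exp y : ℂ)) * ℓ (A[y] v)) y := fun y => by
    have h := hasDerivAt_apply_gardingAct_expGL_raising hτ w hℓ hθ k μ v hW hZ y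
    rw [hR y, mul_zero, add_zero] at h
    exact h
  exact exists_eq_const_mul_exp_of_hasDerivAt
    (g := fun y : ℝ => (μ - k) / 2 - Complex.I * θ * (Real.exp y : ℂ))
    (G := fun y : ℝ => (μ - k) / 2 * y - Complex.I * θ * (Real.exp y : ℂ)) hder fun y => by
      have h := ((hasDerivAt_id y).ofReal_comp.const_mul ((μ - k) / 2)).sub
        ((hasDerivAt_ofReal_exp y).const_mul (Complex.I * θ))
      exact h.congr_deriv (by push_cast; ring)

variable {δ : GL (Fin 2) (mixedSpace K)}
  (hδ : (δ : Matrix (Fin 2) (Fin 2) (mixedSpace K)) = 1 - (2 : ℝ) • Matrix.single (0 : Fin 2) (0 : Fin 2) ((Pi.single w 1, 0) : mixedSpace K))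
include hδ

/-- **The discrete-series type at a real place, modulo the null space.** Let `v` have weight `k`, central
scalar `μ`, with `ℓ(τ(exp yH₀) L_w v) = 0 = ℓ(τ(exp yH₀) τ(δ_w) L_w v)` for all `y` (e.g. `L_w v` in the null space
of the Kirillov map), and `iθ = a > 0`. Then `ℓ(τ(exp yH₀) v) = 0` for all `y`, and
`ℓ(τ(exp yH₀) τ(δ_w) v) = C e^{(μ+k)y/2} e^{-a e^y}` (`τ(δ_w) v` has weight `-k` and `R_w τ(δ_w) v = τ(δ_w) L_w v`).
[cite: JacquetLanglands1970, §5 (Thm. 5.13, 5.15)] -/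
theorem realShape_discrete (hτb : ∀ g, ‖(τ g : E →L[ℂ] E)‖ ≤ 1) {ℓ : archGardingSpace hcpt τ →ₗ[ℂ] ℂ}
    (hℓ : ∃ (C : ℝ) (𝒮 : Finset (List (Matrix (Fin 2) (Fin 2) (mixedSpace K)))), 0 ≤ C ∧
      ∀ v : archGardingSpace hcpt τ, ‖ℓ v‖ ≤ C * ∑ w ∈ 𝒮, ‖archWordDerivE hcpt τ w v‖)
    {θ : ℂ} (hθ : ∀ u : archGardingSpace hcpt τ, ℓ (D X⁺ u) = θ * ℓ u) {a : ℝ} (ha : 0 < a) (hθa : Complex.I * θ = a)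
    (k μ : ℂ) (v : archGardingSpace hcpt τ)
    (hW : D (X⁺ - X⁻) v = (Complex.I * k) • v) (hZ : D H₀ v + D H₁ v = μ • v)
    (hL : ∀ y : ℝ, ℓ (A[y] (Lo v)) = 0) (hLδ : ∀ y : ℝ, ℓ (A[y] (gardingAct hτ δ (Lo v))) = 0) :
    (∀ y : ℝ, ℓ (A[y] v) = 0) ∧
      ∃ C : ℂ, ∀ y : ℝ, ℓ (A[y] (gardingAct hτ δ v)) = C * Complex.exp ((μ + k) / 2 * y + -(a : ℂ) * (Real.exp y : ℂ)) := by
  refine ⟨apply_gardingAct_expGL_eq_zero_of_lowering_mod hτ w hτb hℓ hθ (by rw [hθa, Complex.ofReal_re]; exact ha) k μ v hW hZ hL, ?_⟩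
  have hW' := realSign_weight hτ hδ hW
  have hZ' := realSign_central hτ hδ hZ
  have hRa : ∀ y : ℝ, ℓ (A[y] (Ra (gardingAct hτ δ v))) = 0 := fun y => by
    have h := LinearMap.congr_fun (gardingAct_realSign_mul_lowering_raising hτ w hδ).1 v
    simp only [Module.End.mul_apply] at h
    rw [← h]
    exact hLδ y
  obtain ⟨C, hC⟩ := exists_apply_gardingAct_expGL_eq_of_raising_mod hτ w hℓ hθ (-k) μ (gardingAct hτ δ v) hW' hZ' hRa
  refine ⟨C, fun y => ?_⟩
  rw [hC y]
  congr 1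
  rw [show (μ - -k) / 2 * (y : ℂ) - Complex.I * θ * (Real.exp y : ℂ) = (μ + k) / 2 * y + -(Complex.I * θ) * (Real.exp y : ℂ) by ring,
    hθa]

/-- `ℓ ∘ τ(δ_w)` has the `X⁺_w`-character `-θ`. [folklore] -/
theorem apply_gardingAct_realSign_gardingEnd_xPlus {ℓ : archGardingSpace hcpt τ →ₗ[ℂ] ℂ} {θ : ℂ}
    (hθ : ∀ u : archGardingSpace hcpt τ, ℓ (D X⁺ u) = θ * ℓ u) (u : archGardingSpace hcpt τ) :
    ℓ (gardingAct hτ δ (D X⁺ u)) = -θ * ℓ (gardingAct hτ δ u) := by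
  have h := (gardingAct_realSign_mul_letters hτ hδ).2.2.1
  rw [← Module.End.mul_apply, h, LinearMap.smul_apply, Module.End.mul_apply, map_smul, hθ, smul_eq_mul]
  ring

/-- **The weight-one type at a real place, symmetrised.** For `v` of weight `1` with `(2κ)² = 2λ - μ² + 1`,
`κ ≠ 0`, `θ² = -a²`, the vector `e = (1 + τ(δ_w))(v + (2κ)⁻¹ L_w v)` has
`ℓ(τ(exp yH₀) e) = c (e^y)^{(μ+1)/2} besselMode a (i(κ-½)) (e^y)` (the weight-one combination for `ℓ` and for
`ℓ ∘ τ(δ_w)`, whose `X⁺`-character is `-θ`), and `τ(δ_w) e = e`.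
[cite: JacquetLanglands1970, §5 (Thm. 5.13)] [cite: Bump1997, §2.8] -/
theorem realShape_weightOne_symm (hτb : ∀ g, ‖(τ g : E →L[ℂ] E)‖ ≤ 1) {ℓ : archGardingSpace hcpt τ →ₗ[ℂ] ℂ}
    (hℓ : ∃ (C : ℝ) (𝒮 : Finset (List (Matrix (Fin 2) (Fin 2) (mixedSpace K)))), 0 ≤ C ∧
      ∀ v : archGardingSpace hcpt τ, ‖ℓ v‖ ≤ C * ∑ w ∈ 𝒮, ‖archWordDerivE hcpt τ w v‖)
    {θ : ℂ} (hθ : ∀ u : archGardingSpace hcpt τ, ℓ (D X⁺ u) = θ * ℓ u)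
    {a : ℝ} (ha : 0 < a) (hθa : θ ^ 2 = -((a : ℂ) ^ 2))
    (μ lam κ : ℂ) (hκ : (2 * κ) ^ 2 = 2 * lam - μ ^ 2 + 1) (hκ0 : κ ≠ 0) (v : archGardingSpace hcpt τ)
    (hW : D (X⁺ - X⁻) v = Complex.I • v) (hZ : D H₀ v + D H₁ v = μ • v)
    (hC : ∑ i : Fin 2, ∑ j : Fin 2, D (Matrix.single i j ((Pi.single w 1, 0) : mixedSpace K))
        (D (Matrix.single j i ((Pi.single w 1, 0) : mixedSpace K)) v) = lam • v) :
    gardingAct hτ δ ((1 + gardingAct hτ δ) (v + (1 / (2 * κ)) • Lo v)) = (1 + gardingAct hτ δ) (v + (1 / (2 * κ)) • Lo v) ∧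
    ∃ c : ℂ, ∀ y : ℝ, ℓ (A[y] ((1 + gardingAct hτ δ) (v + (1 / (2 * κ)) • Lo v))) =
      c * (Real.exp y : ℂ) ^ ((μ + 1) / 2) * besselMode a (Complex.I * (κ - 1 / 2)) (Real.exp y) := by
  have hδδ := gardingAct_realSign_mul_self hτ hδ
  refine ⟨?_, ?_⟩
  · rw [LinearMap.add_apply, Module.End.one_apply, map_add, ← Module.End.mul_apply, hδδ, Module.End.one_apply, add_comm]
  -- the combination for `ℓ` and for `ℓ ∘ τ(δ)`
  obtain ⟨c₁, hc₁⟩ := exists_weightOne_combination_eq_besselMode hτ w hτb hℓ hθ ha hθa μ lam κ hκ hκ0 v hW hZ hC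
  have hℓ' := exists_seminormBound_comp_gardingAct hτ hτb hℓ δ
  have hθ' : ∀ u : archGardingSpace hcpt τ, (ℓ ∘ₗ gardingAct hτ δ) (D X⁺ u) = -θ * (ℓ ∘ₗ gardingAct hτ δ) u :=
    fun u => apply_gardingAct_realSign_gardingEnd_xPlus hτ w hδ hθ u
  have hθa' : (-θ) ^ 2 = -((a : ℂ) ^ 2) := by rw [neg_sq, hθa]
  obtain ⟨c₂, hc₂⟩ := exists_weightOne_combination_eq_besselMode hτ w hτb (ℓ := ℓ ∘ₗ gardingAct hτ δ)
    (by simpa only [LinearMap.coe_comp, Function.comp_apply] using hℓ') hθ' ha hθa' μ lam κ hκ hκ0 v hW hZ hC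
  refine ⟨c₁ + c₂, fun y => ?_⟩
  have e : A[y] ((1 + gardingAct hτ δ) (v + (1 / (2 * κ)) • Lo v)) =
      A[y] (v + (1 / (2 * κ)) • Lo v) + gardingAct hτ δ (A[y] (v + (1 / (2 * κ)) • Lo v)) := by
    rw [LinearMap.add_apply, Module.End.one_apply, map_add, ← Module.End.mul_apply (A[y]) (gardingAct hτ δ),
      gardingAct_expGL_mul_realSign hτ hδ, Module.End.mul_apply]
  have h1 : ℓ (A[y] (v + (1 / (2 * κ)) • Lo v)) = ℓ (A[y] v) + 1 / (2 * κ) * ℓ (A[y] (Lo v)) := by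
    rw [map_add, map_smul, map_add, map_smul, smul_eq_mul]
  have h2 : ℓ (gardingAct hτ δ (A[y] (v + (1 / (2 * κ)) • Lo v))) =
      (ℓ ∘ₗ gardingAct hτ δ) (A[y] v) + 1 / (2 * κ) * (ℓ ∘ₗ gardingAct hτ δ) (A[y] (Lo v)) := by
    rw [map_add, map_smul, map_add, map_smul, map_add, map_smul, smul_eq_mul, LinearMap.coe_comp, Function.comp_apply,
      Function.comp_apply]
  rw [e, map_add, h1, h2, hc₁ y, hc₂ y]
  ring

/-- **The weight-zero type at a real place**: for `v` of weight `0` (`τ(W_w) v = 0`) the Kirillov function along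
`exp(ℝH₀)` is `c (e^y)^{μ/2} besselMode a ν (e^y)` with `λ = μ²/2 - 2ν² - ½` (`ArchKirillovBesselGL2Real`), and the
same for `τ(δ_w) v` (which is again of weight `0`). [cite: JacquetLanglands1970, §5 (Thm. 5.13)] -/
theorem realShape_weightZero (hτb : ∀ g, ‖(τ g : E →L[ℂ] E)‖ ≤ 1) {ℓ : archGardingSpace hcpt τ →ₗ[ℂ] ℂ}
    (hℓ : ∃ (C : ℝ) (𝒮 : Finset (List (Matrix (Fin 2) (Fin 2) (mixedSpace K)))), 0 ≤ C ∧
      ∀ v : archGardingSpace hcpt τ, ‖ℓ v‖ ≤ C * ∑ w ∈ 𝒮, ‖archWordDerivE hcpt τ w v‖)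
    {θ : ℂ} (hθ : ∀ u : archGardingSpace hcpt τ, ℓ (D X⁺ u) = θ * ℓ u)
    {a : ℝ} (ha : 0 < a) (hθa : θ ^ 2 = -((a : ℂ) ^ 2))
    (μ lam ν : ℂ) (hlam : lam = μ ^ 2 / 2 - 2 * ν ^ 2 - 1 / 2) (v : archGardingSpace hcpt τ)
    (hW : D (X⁺ - X⁻) v = 0) (hZ : D H₀ v + D H₁ v = μ • v)
    (hC : ∑ i : Fin 2, ∑ j : Fin 2, D (Matrix.single i j ((Pi.single w 1, 0) : mixedSpace K))
        (D (Matrix.single j i ((Pi.single w 1, 0) : mixedSpace K)) v) = lam • v) :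
    (∃ c : ℂ, ∀ y : ℝ, ℓ (A[y] v) = c * (Real.exp y : ℂ) ^ (μ / 2) * besselMode a ν (Real.exp y)) ∧
    ∃ c : ℂ, ∀ y : ℝ, ℓ (A[y] (gardingAct hτ δ v)) = c * (Real.exp y : ℂ) ^ (μ / 2) * besselMode a ν (Real.exp y) :=
  ⟨exists_apply_gardingAct_expGL_eq_besselMode hτ w hτb hℓ hθ ha hθa μ lam ν hlam v hW hZ hC,
    exists_apply_gardingAct_expGL_realSign_eq_besselMode hτ w hδ hτb hℓ hθ ha hθa μ lam ν hlam v hW hZ hC⟩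

omit hδ in
/-- For `v` of weight `0`, `τ(X⁺_w + X⁻_w) v = 2 τ(X⁺_w) v`, whence
`ℓ(τ(exp yH₀) τ(X⁺_w + X⁻_w) v) = 2θ e^y ℓ(τ(exp yH₀) v)`. [folklore] -/
theorem apply_gardingAct_expGL_xSum_of_weightZero {ℓ : archGardingSpace hcpt τ →ₗ[ℂ] ℂ} {θ : ℂ}
    (hθ : ∀ u : archGardingSpace hcpt τ, ℓ (D X⁺ u) = θ * ℓ u) (v : archGardingSpace hcpt τ) (hW : D (X⁺ - X⁻) v = 0) (y : ℝ) :
    D (X⁺ + X⁻) v = (2 : ℂ) • D X⁺ v ∧ ℓ (A[y] (D (X⁺ + X⁻) v)) = 2 * ((Real.exp y : ℂ) * θ) * ℓ (A[y] v) := by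
  have e : D (X⁺ + X⁻) v = (2 : ℂ) • D X⁺ v := by
    rw [gardingEnd_sub, LinearMap.sub_apply, sub_eq_zero] at hW
    rw [gardingEnd_add, LinearMap.add_apply, ← hW, two_smul]
  refine ⟨e, ?_⟩
  rw [e, map_smul, map_smul, apply_gardingAct_expGL_xPlus hτ w hθ v y, smul_eq_mul]
  ring

/-- **The weight-zero type with `τ(δ_w) v = -v`**: the vector `τ(X⁺_w + X⁻_w) v` is `τ(δ_w)`-FIXED and its
Kirillov function along `exp(ℝH₀)` is `2θ e^y` times that of `v`. [folklore] -/
theorem realShape_weightZero_xSum {v : archGardingSpace hcpt τ} (hv : gardingAct hτ δ v = -v) :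
    gardingAct hτ δ (D (X⁺ + X⁻) v) = D (X⁺ + X⁻) v := by
  obtain ⟨-, -, h3, h4⟩ := gardingAct_realSign_mul_letters hτ hδ
  rw [gardingEnd_add, LinearMap.add_apply, map_add, ← Module.End.mul_apply, ← Module.End.mul_apply, h3, h4,
    LinearMap.smul_apply, LinearMap.smul_apply, Module.End.mul_apply, Module.End.mul_apply, hv, map_neg, map_neg]
  simp

end RealPlace

end Literature.NumberTheory.Automorphic
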